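import Literature.Claims.NS.Alneel2026
import Literature.Analysis.FluidPDE.SobolevWholeSpace
import Literature.Analysis.FluidPDE.TaoEnstrophyLocalisationProofs
import Literature.Analysis.FluidPDE.CaloricLocalLerayLp
import Mathlib.MeasureTheory.Measure.Lebesgue.EqHaar
import HarnessLib

/-!
# Solo salvage for claim C156 `Alneel2026` (cell `ns-claims`, D-0090), second file: the TRUE direction of the
# «scale law» — energy concentrated in a ball FORCES enstrophy (Poincaré–Sobolev), kernel

Claim skeleton: `Literature/Claims/NS/Alneel2026.lean` (Zenodo 21706638; typist `ns-claims-typist-3` g6). Row C156 is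
ADJUDICATED #145 (head `Step_P3tail`, false lemma ∀C); Theorem 2.1 «R(t)²X(t) ≤ 16 C_GN E₀» is refuted for every
`C` (`…Theorems.Alneel2026Second.not_Thm21`) and the method-level no-go is the barrier
`Literature.Barriers.NavierStokesRegularity.EnergyDispersal.EnergyDispersalNoEnstrophyControl`. This file (seat
`ns-claims-salvage-p3` g5, records-grade, off the verdict) proves the CONVERSE direction, which IS true and is
the printed «reverse law» of Point 3 p.3 l.25–28 («Using Theorem 2.1, X(s) ≥ 16C_GN E₀/R(s)²») read on data
with a small constant:

* `locEnergy_le_volume_rpow_mul_XeF` — for a `C¹` field `w : ℝ³ → ℝ³` with `w ∈ L²`: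
  `∫_{B(x₀,r)}|w|² ≤ |B(x₀,r)|^{2/3} · K² · ∫|∇w|²_F` (Hölder on the ball with exponents `3, 3/2` + the
  Gagliardo–Nirenberg–Sobolev embedding `‖w‖_{L⁶} ≤ K‖∇w‖_{L²}`, `K` = Mathlib's `SNormLESNormFDerivOfEqConst E3 volume 2`,
  + `‖Dw‖²_op ≤ |Dw|²_F`);
* `scaleLaw_reverse_onData` — `∃ c > 0, OnData (fun E₀ w => ofReal (c·E₀) ≤ Rinf E₀ w² · ofReal (XF w))`: at
  `t = 0` the half-energy radius and the enstrophy of every Clay/BKM datum satisfy `R⁻²·X ≥ c·E₀` — the energy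
  CAN be concentrated only where the gradient pays for it (uncertainty / Poincaré), the one-sided truth behind the
  (false) two-sided «scale law».

Solo lane (`Theorems/SoloSalvage<Slug>….lean`, no item); records-grade, no token effect.

WHAT THIS IS NOT: not a claim about NS regularity or blow-up; not a claim about any author beyond the
typed locator.
-/

noncomputable section

set_option linter.dupNamespace false

open Set MeasureTheory Filter Metric
open scoped ENNReal NNReal Topology

namespace Summit.NavierStokesRegularity.NavierStokesRegularity.Theorems.Alneel2026Salvage

open Literature.Analysis Literature.Analysis.FluidPDE
open Literature.Claims.NS Literature.Claims.NS.Alneel2026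
open Literature.Claims.NS.Chae2007 (IsDatum)

/-! ## The local energy is controlled by the enstrophy (Hölder on the ball + Sobolev) -/

/-- `∫⁻ ‖g‖ₑ² = ‖g‖₂²`. [folklore] -/
private theorem lintegral_enorm_sq_eq {α F : Type*} [MeasurableSpace α] {μ : Measure α} [NormedAddCommGroup F]
    (g : α → F) : ∫⁻ x, ‖g x‖ₑ ^ 2 ∂μ = eLpNorm g 2 μ ^ 2 := by
  have h := lintegral_rpow_enorm_rpow_two_div (μ := μ) g (p := 2) two_ne_zero ENNReal.ofNat_ne_top
  rw [ENNReal.toReal_ofNat, div_self two_ne_zero, ENNReal.rpow_one] at h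
  rw [← h]
  exact lintegral_congr fun x => by rw [ENNReal.rpow_two]

/-- `∫⁻ ‖Dw‖ₑ² ≤ ∫⁻ |Dw|²_F` (operator norm versus Frobenius norm, pointwise). [folklore] -/
theorem lintegral_enorm_fderiv_sq_le_XeF (w : E3 → E3) :
    ∫⁻ x, ‖fderiv ℝ w x‖ₑ ^ 2 ≤ XeF w := by
  unfold XeF
  refine lintegral_mono fun x => ?_
  rw [← ofReal_norm, ← ENNReal.ofReal_pow (norm_nonneg _)]
  exact ENNReal.ofReal_le_ofReal (sq_opNorm_le_frobeniusNormSq _)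

/-- **Local energy ≤ |ball|^{2/3} · K² · enstrophy**: for `w ∈ C¹(ℝ³; ℝ³) ∩ L²`, every centre `x₀` and radius
`r`, `∫_{B(x₀,r)}|w|² ≤ |B(x₀,r)|^{2/3} K² ∫|∇w|²_F` (in `[0,∞]`). Hölder with exponents `(3, 3/2)` on the ball,
Sobolev `‖w‖_{L⁶} ≤ K‖Dw‖_{L²}`, `‖Dw‖² ≤ |Dw|²_F`. [cite: Evans2010, §5.6.1 Thm. 1–2] -/
theorem locEnergy_le_volume_rpow_mul_XeF {w : E3 → E3} (hw : ContDiff ℝ 1 w)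
    (hL2 : eLpNorm w 2 (volume : Measure E3) < ⊤) (x₀ : E3) (r : ℝ) :
    locEnergy w x₀ r ≤ volume (ball x₀ r) ^ (2 / 3 : ℝ) * (((SNormLESNormFDerivOfEqConst E3 (volume : Measure E3) 2 : ℝ≥0) : ℝ≥0∞) ^ 2 * XeF w) := by
  have hE : Module.finrank ℝ E3 = 3 := finrank_euclideanSpace_fin
  -- Hölder on the ball, `p = 6`
  have h1 := setLIntegral_enorm_sq_le_measure_rpow_mul (μ := (volume : Measure E3)) (s := ball x₀ r)
    (f := w) (p := 6) (by norm_num) (by norm_num) hw.continuous.aestronglyMeasurable.restrict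
  have e6 : (6 : ℝ≥0∞).toReal = 6 := by norm_num
  rw [e6] at h1
  have e23 : (1 - 2 / 6 : ℝ) = 2 / 3 := by norm_num
  rw [e23] at h1
  -- the `L⁶` piece on the ball is at most the whole-space one, `= ‖w‖₆²`
  have h2 : (∫⁻ x in ball x₀ r, ‖w x‖ₑ ^ (6 : ℝ)) ^ (2 / 6 : ℝ) ≤ eLpNorm w 6 volume ^ 2 := by
    have hmono : (∫⁻ x in ball x₀ r, ‖w x‖ₑ ^ (6 : ℝ)) ≤ ∫⁻ x, ‖w x‖ₑ ^ (6 : ℝ) :=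
      setLIntegral_le_lintegral _ _
    have h := ENNReal.rpow_le_rpow hmono (by norm_num : (0 : ℝ) ≤ 2 / 6)
    refine h.trans (le_of_eq ?_)
    have := lintegral_rpow_enorm_rpow_two_div (μ := (volume : Measure E3)) w (p := 6) (by norm_num) (by norm_num)
    rw [e6] at this
    exact this
  -- Sobolev
  have h3 : eLpNorm w 6 volume ^ 2 ≤ ((SNormLESNormFDerivOfEqConst E3 (volume : Measure E3) 2 : ℝ≥0) : ℝ≥0∞) ^ 2 * ∫⁻ x, ‖fderiv ℝ w x‖ₑ ^ 2 := by
    have hs := eLpNorm_six_le_eLpNorm_fderiv_two (volume : Measure E3) hE hw hL2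
    have := pow_le_pow_left' hs 2
    rw [mul_pow, ← lintegral_enorm_sq_eq] at this
    exact this
  have h4 := lintegral_enorm_fderiv_sq_le_XeF w
  unfold locEnergy
  calc ∫⁻ y in ball x₀ r, ‖w y‖ₑ ^ 2
      ≤ volume (ball x₀ r) ^ (2 / 3 : ℝ) * (∫⁻ x in ball x₀ r, ‖w x‖ₑ ^ (6 : ℝ)) ^ (2 / 6 : ℝ) := h1
    _ ≤ volume (ball x₀ r) ^ (2 / 3 : ℝ) * (((SNormLESNormFDerivOfEqConst E3 (volume : Measure E3) 2 : ℝ≥0) : ℝ≥0∞) ^ 2 * XeF w) := by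
        gcongr
        exact h2.trans (h3.trans (by gcongr))

/-! ## Consequence for data: the reverse scale law `R⁻² · X ≥ c · E₀` -/

/-- For a datum, the total squared `L²` mass is finite (`IsDatum`, `n = 0`). [folklore] -/
theorem lintegral_enorm_sq_lt_top_of_isDatum {w : E3 → E3} (hw : IsDatum w) : ∫⁻ x, ‖w x‖ₑ ^ 2 < ⊤ := by
  have h := hw.2.2 0
  simp only [norm_iteratedFDeriv_zero, ← ofReal_norm] at h ⊢
  simpa using h

/-- For a datum, the enstrophy `XeF` is finite (`IsDatum`, `n = 1`, and `|L|²_F ≤ 3‖L‖²`). [folklore] -/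
theorem XeF_lt_top_of_isDatum {w : E3 → E3} (hw : IsDatum w) : XeF w < ⊤ := by
  have h1 : ∫⁻ x, ‖iteratedFDeriv ℝ 1 w x‖ₑ ^ 2 < ⊤ := hw.2.2 1
  have hpt : ∀ x, ENNReal.ofReal (frobeniusNormSq (fderiv ℝ w x)) ≤ 3 * ‖iteratedFDeriv ℝ 1 w x‖ₑ ^ 2 := by
    intro x
    have hf : frobeniusNormSq (fderiv ℝ w x) ≤ 3 * ‖fderiv ℝ w x‖ ^ 2 := by
      have hcard : (Fintype.card (Fin (Module.finrank ℝ E3)) : ℝ) = 3 := by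
        rw [Fintype.card_fin, finrank_euclideanSpace_fin]; norm_num
      unfold frobeniusNormSq
      calc ∑ i, ‖fderiv ℝ w x (stdOrthonormalBasis ℝ E3 i)‖ ^ 2
          ≤ Fintype.card (Fin (Module.finrank ℝ E3)) * ‖fderiv ℝ w x‖ ^ 2 :=
            sum_sq_norm_apply_le_card_mul_sq_opNorm _ _
        _ = 3 * ‖fderiv ℝ w x‖ ^ 2 := by rw [hcard]
    have e1 : ‖iteratedFDeriv ℝ 1 w x‖ = ‖fderiv ℝ w x‖ := norm_iteratedFDeriv_one w
    rw [← ofReal_norm, e1, ← ENNReal.ofReal_pow (norm_nonneg _), show (3 : ℝ≥0∞) = ENNReal.ofReal 3 by norm_num,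
      ← ENNReal.ofReal_mul (by norm_num)]
    exact ENNReal.ofReal_le_ofReal hf
  unfold XeF
  calc ∫⁻ x, ENNReal.ofReal (frobeniusNormSq (fderiv ℝ w x))
      ≤ ∫⁻ x, 3 * ‖iteratedFDeriv ℝ 1 w x‖ₑ ^ 2 := lintegral_mono hpt
    _ = 3 * ∫⁻ x, ‖iteratedFDeriv ℝ 1 w x‖ₑ ^ 2 := by
        rw [lintegral_const_mul' _ _ (by norm_num)]
    _ < ⊤ := ENNReal.mul_lt_top (by norm_num) h1

/-- A non-trivial datum has a cap radius: some ball `B(0,n)` already holds `E₀/2 = ¼∫|w|²` (continuity of the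
measure `|w|² dx` from below along the balls `B(0,n) ↑ ℝ³`). [folklore] -/
theorem capRadii_nonempty {w : E3 → E3} (hw : IsDatum w) (hE : 0 < energyF w) :
    (capRadii (energyF w) w).Nonempty := by
  set T : ℝ≥0∞ := ∫⁻ x, ‖w x‖ₑ ^ 2 with hT
  have hTtop : T < ⊤ := lintegral_enorm_sq_lt_top_of_isDatum hw
  have hT0 : T ≠ 0 := by
    intro h0
    simp [energyF, ← hT, h0] at hE
  have hTpos : 0 < T.toReal := ENNReal.toReal_pos hT0 hTtop.ne
  -- `ofReal (E₀/2) < T`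
  have hquarter : ENNReal.ofReal (energyF w / 2) < T := by
    have hreal : energyF w / 2 = T.toReal / 4 := by simp only [energyF, ← hT]; ring
    rw [hreal]
    calc ENNReal.ofReal (T.toReal / 4) < ENNReal.ofReal T.toReal :=
          (ENNReal.ofReal_lt_ofReal_iff hTpos).2 (by linarith)
      _ = T := ENNReal.ofReal_toReal hTtop.ne
  -- the measure `|w|² dx` along the balls `B(0,n)`
  set ν : Measure E3 := volume.withDensity fun x => ‖w x‖ₑ ^ 2 with hν
  have hνball : ∀ n : ℕ, ν (ball (0 : E3) n) = ∫⁻ x in ball (0 : E3) n, ‖w x‖ₑ ^ 2 := fun n =>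
    withDensity_apply _ measurableSet_ball
  have hνuniv : ν univ = T := by rw [hν, withDensity_apply _ MeasurableSet.univ, Measure.restrict_univ]
  have hmono : Monotone fun n : ℕ => ball (0 : E3) (n : ℝ) := fun a b hab =>
    ball_subset_ball (by exact_mod_cast hab)
  have htend : Tendsto (fun n : ℕ => ν (ball (0 : E3) n)) atTop (𝓝 (ν univ)) := by
    have h := tendsto_measure_iUnion_atTop (μ := ν) hmono
    rwa [iUnion_ball_nat] at h
  rw [hνuniv] at htend
  have hev := (tendsto_order.1 htend).1 _ hquarter
  obtain ⟨n, hn, hn1⟩ := (hev.and (eventually_ge_atTop 1)).exists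
  refine ⟨n, by exact_mod_cast Nat.one_le_iff_ne_zero.mp hn1 |> Nat.pos_of_ne_zero, (0 : E3), ?_⟩
  rw [locEnergy, ← hνball n]
  exact hn.le

/-- **The reverse scale law on data** (Point 3 p.3 l.25–28 read at `t = 0`, small constant): there is `c > 0`
such that for every datum `w` (smooth, divergence-free, all Sobolev norms finite), with `E₀ = E(w) = ½∫|w|²`,
`R⁻(w)² · X(w) ≥ c · E₀` — the half-energy radius of Def 1.2 (charitable infimum) and the enstrophy control
the energy from ABOVE (concentration costs gradient). Proof: every cap radius `r` satisfies
`E₀/2 ≤ ∫_{B(x₀,r)}|w|² ≤ c₁ r² X` (`locEnergy_le_volume_rpow_mul_XeF`, `|B(x₀,r)| = r³|B₁|`), hence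
`√(cE₀/X) ≤ r` and the infimum inherits the bound. [cite: Alneel2026, Point 3 p.3 l.25–28]
[cite: Evans2010, §5.6.1 Thm. 1–2] -/
theorem scaleLaw_reverse_onData : ∃ c : ℝ, 0 < c ∧
    OnData fun E₀ w => ENNReal.ofReal (c * E₀) ≤ Rinf E₀ w ^ 2 * ENNReal.ofReal (XF w) := by
  have hE3 : Module.finrank ℝ E3 = 3 := finrank_euclideanSpace_fin
  set V₁ : ℝ≥0∞ := volume (ball (0 : E3) 1) with hV₁
  have hV₁top : V₁ < ⊤ := measure_ball_lt_top
  set A : ℝ≥0∞ := V₁ ^ (2 / 3 : ℝ) * ((SNormLESNormFDerivOfEqConst E3 (volume : Measure E3) 2 : ℝ≥0) : ℝ≥0∞) ^ 2 with hA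
  have hAtop : A ≠ ⊤ := by
    refine ENNReal.mul_ne_top (ENNReal.rpow_ne_top_of_nonneg (by norm_num) hV₁top.ne) ?_
    exact ENNReal.pow_ne_top ENNReal.coe_ne_top
  set c₁ : ℝ := A.toReal with hc₁
  have hc₁0 : 0 ≤ c₁ := ENNReal.toReal_nonneg
  refine ⟨1 / (2 * (c₁ + 1)), by positivity, ?_⟩
  intro w hw
  have hE0 : 0 ≤ energyF w := by unfold energyF; positivity
  rcases hE0.eq_or_lt with hE | hE
  · -- zero energy: the left side vanishes
    rw [← hE, mul_zero, ENNReal.ofReal_zero]; exact bot_le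
  -- finite enstrophy
  have hXtop : XeF w ≠ ⊤ := (XeF_lt_top_of_isDatum hw).ne
  have hXF : ENNReal.ofReal (XF w) = XeF w := by rw [XF, ENNReal.ofReal_toReal hXtop]
  have hXF0 : 0 ≤ XF w := ENNReal.toReal_nonneg
  have hL2 : eLpNorm w 2 (volume : Measure E3) < ⊤ := by
    rw [← ENNReal.rpow_lt_top_iff_of_pos (by norm_num : (0 : ℝ) < 2), ENNReal.rpow_two,
      ← lintegral_enorm_sq_eq]
    exact lintegral_enorm_sq_lt_top_of_isDatum hw
  -- the key real inequality for every cap radius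
  have hkey : ∀ r ∈ capRadii (energyF w) w, 1 / (2 * (c₁ + 1)) * energyF w ≤ r ^ 2 * XF w := by
    rintro r ⟨hr, x₀, hx₀⟩
    have hball : volume (ball x₀ r) = ENNReal.ofReal (r ^ 3) * V₁ := by
      rw [Measure.addHaar_ball volume x₀ hr.le, hE3]
    have hvol : volume (ball x₀ r) ^ (2 / 3 : ℝ) = ENNReal.ofReal (r ^ 2) * V₁ ^ (2 / 3 : ℝ) := by
      rw [hball, ENNReal.mul_rpow_of_nonneg _ _ (by norm_num), ENNReal.ofReal_rpow_of_nonneg (by positivity)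
        (by norm_num), ← Real.rpow_natCast, ← Real.rpow_mul hr.le]
      norm_num
    have h := hx₀.trans (locEnergy_le_volume_rpow_mul_XeF (hw.1.of_le (by exact_mod_cast le_top)) hL2 x₀ r)
    rw [hvol, mul_assoc, ← mul_assoc (V₁ ^ (2 / 3 : ℝ)), ← hA, ← hXF, ← ENNReal.ofReal_toReal hAtop, ← hc₁,
      ← ENNReal.ofReal_mul hc₁0, ← ENNReal.ofReal_mul (by positivity),
      ENNReal.ofReal_le_ofReal_iff (by positivity)] at h
    -- `E₀/2 ≤ r²·(c₁·X)` ⇒ `E₀/(2(c₁+1)) ≤ r²·X`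
    have hrX : 0 ≤ r ^ 2 * XF w := by positivity
    have h1 : 1 / (2 * (c₁ + 1)) * energyF w = (energyF w / 2) / (c₁ + 1) := by
      field_simp
    rw [h1, div_le_iff₀ (by positivity)]
    nlinarith
  -- a cap radius exists, so `X > 0`
  obtain ⟨r₀, hr₀⟩ := capRadii_nonempty hw hE
  have hc0 : 0 < 1 / (2 * (c₁ + 1)) * energyF w := by positivity
  have hX0 : 0 < XF w := by
    have h := hkey r₀ hr₀
    have hr₀2 : 0 < r₀ ^ 2 := by have := hr₀.1; positivity
    by_contra hX
    have : XF w = 0 := le_antisymm (not_lt.1 hX) hXF0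
    rw [this, mul_zero] at h
    linarith
  -- `√(cE₀/X) ≤ R⁻`
  set ρ : ℝ := Real.sqrt (1 / (2 * (c₁ + 1)) * energyF w / XF w) with hρ
  have hρR : ENNReal.ofReal ρ ≤ Rinf (energyF w) w := by
    refine le_sInf ?_
    rintro s ⟨r, hr, rfl⟩
    refine ENNReal.ofReal_le_ofReal ?_
    have h := hkey r hr
    rw [hρ, ← Real.sqrt_sq hr.1.le]
    exact Real.sqrt_le_sqrt ((div_le_iff₀ hX0).2 h)
  have hρ0 : 0 ≤ ρ := Real.sqrt_nonneg _
  calc ENNReal.ofReal (1 / (2 * (c₁ + 1)) * energyF w)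
      = ENNReal.ofReal (ρ ^ 2 * XF w) := by
        rw [hρ, Real.sq_sqrt (by positivity), div_mul_cancel₀ _ hX0.ne']
    _ = ENNReal.ofReal ρ ^ 2 * ENNReal.ofReal (XF w) := by
        rw [ENNReal.ofReal_mul (by positivity), ENNReal.ofReal_pow hρ0]
    _ ≤ Rinf (energyF w) w ^ 2 * ENNReal.ofReal (XF w) := by
        gcongr

end Summit.NavierStokesRegularity.NavierStokesRegularity.Theorems.Alneel2026Salvage

end
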